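import Literature.MathematicalPhysics.StatisticalMechanics.BarlowCoordination

/-!
# `StackingHinge` (stmt-AtomisticToContinuum-14993), line `Sketch`: stub `stub_barlowShellSupport`

**Angular covering of the touching shell of an ideal Barlow stacking.** For `0 < a`, a Hägg
sequence `s` and the ideal layer spacing `h = a √(2/3)`, every site `z'` of
`barlowStacking a h s` and every vector `e : ℝ³` admit a *touching* neighbour `z''`
(`dist z' z'' = a`) with `9/20 · a · ‖e‖ ≤ ⟪z'' − z', e⟫` (the true constant is `1/√2`).

Proof. Write `z' = barlowPos a h s k i j`; the twelve touching sites are the images of the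
offsets `sixOffsets` (layer `k`), `threeOffsets (−s k)` (layer `k + 1`) and `threeOffsets (s (k−1))`
(layer `k − 1`) under `offsetPos` (`BarlowCoordination.touching_eq_union`). In coordinates
(`inner_offsetPos_sub`) the six in-layer differences are `±u, ±v, ±(u − v)`, whose pairings with
`e` are `±A, ±B, ±C` with `A² + B² + C² = (3/2) a² ((e 0)² + (e 1)²)`, so the largest is
`≥ a √(((e 0)² + (e 1)²)/2)` (`exists_sixOffsets_sq_le`); the three upper (lower) differences have
third coordinate `+h` (`−h`) and horizontal parts summing to zero, so one of them pairs with `e` to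
at least `h · e 2` (`−h · e 2`) (`exists_threeOffsets_nonneg`). Since
`max (a² P / 2, (2/3) a² Q) ≥ (2/7) a² (P + Q) ≥ (81/400) a² ‖e‖²` (`shell_bound`), the better
candidate works. All [folklore].
-/

noncomputable section

namespace Summit.AtomisticToContinuum.Crystallization.Theorems.PricedHcpWindowsBarlowShellSupport

open Literature.MathematicalPhysics.StatisticalMechanics

/-- The real inner product on `ℝ³` in coordinates. [folklore] -/
theorem real_inner_eq_sum_three (x y : EuclideanSpace ℝ (Fin 3)) :
    inner ℝ x y = x 0 * y 0 + x 1 * y 1 + x 2 * y 2 := by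
  rw [PiLp.inner_apply, Fin.sum_univ_three, RCLike.inner_apply, RCLike.inner_apply,
    RCLike.inner_apply, conj_trivial, conj_trivial, conj_trivial]
  ring

/-- **The pairing of a shell difference with `e` in coordinates**: for the site
`offsetPos a h s i j k' PQ = barlowPos a h s k' (i − P) (j − Q)`,
`⟪offsetPos − barlowPos k i j, e⟫ = (−P − Q/2 + Λ'/2) · a e₀ + (−Q + Λ'/3) · (a√3/2) e₁ + (k' − k) h e₂`
with `Λ' = L k' − L k`. [folklore] -/
theorem inner_offsetPos_sub (a h : ℝ) (s : ℤ → ℤ) (e : EuclideanSpace ℝ (Fin 3))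
    (k i j k' : ℤ) (PQ : ℤ × ℤ) :
    inner ℝ (offsetPos a h s i j k' PQ - barlowPos a h s k i j) e =
      (-(PQ.1 : ℝ) - (PQ.2 : ℝ) / 2 + ((haggLabel s k' : ℝ) - haggLabel s k) / 2) * (a * e 0) +
      (-(PQ.2 : ℝ) + ((haggLabel s k' : ℝ) - haggLabel s k) / 3) * (a * √3 / 2 * e 1) +
      ((k' : ℝ) - k) * h * e 2 := by
  rw [real_inner_eq_sum_three, PiLp.sub_apply, PiLp.sub_apply, PiLp.sub_apply, offsetPos,
    barlowPos_apply_zero, barlowPos_apply_zero, barlowPos_apply_one, barlowPos_apply_one,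
    barlowPos_apply_two, barlowPos_apply_two]
  push_cast
  ring

/-- **In-layer hexagon covers the horizontal directions**: among the six pairings
`±x, ±(x/2 + y), ±(x/2 − y)` of the in-layer shell differences (offsets `sixOffsets`) one is
nonnegative with square `≥ x²/2 + (2/3) y²` (the mean of the three squares). [folklore] -/
theorem exists_sixOffsets_sq_le (x y : ℝ) :
    ∃ PQ ∈ sixOffsets, 0 ≤ (-(PQ.1 : ℝ) - (PQ.2 : ℝ) / 2) * x + -(PQ.2 : ℝ) * y ∧
      x ^ 2 / 2 + 2 / 3 * y ^ 2 ≤ ((-(PQ.1 : ℝ) - (PQ.2 : ℝ) / 2) * x + -(PQ.2 : ℝ) * y) ^ 2 := by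
  by_cases hAB : (x / 2 + y) ^ 2 ≤ x ^ 2
  · by_cases hAC : (x / 2 - y) ^ 2 ≤ x ^ 2
    · rcases le_or_gt 0 x with hx | hx
      · refine ⟨(-1, 0), by decide, ?_, ?_⟩ <;> norm_num <;> nlinarith
      · refine ⟨(1, 0), by decide, ?_, ?_⟩ <;> norm_num <;> nlinarith
    · rcases le_or_gt 0 (x / 2 - y) with hC | hC
      · refine ⟨(-1, 1), by decide, ?_, ?_⟩ <;> norm_num <;> nlinarith
      · refine ⟨(1, -1), by decide, ?_, ?_⟩ <;> norm_num <;> nlinarith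
  · by_cases hBC : (x / 2 - y) ^ 2 ≤ (x / 2 + y) ^ 2
    · rcases le_or_gt 0 (x / 2 + y) with hB | hB
      · refine ⟨(0, -1), by decide, ?_, ?_⟩ <;> norm_num <;> nlinarith
      · refine ⟨(0, 1), by decide, ?_, ?_⟩ <;> norm_num <;> nlinarith
    · rcases le_or_gt 0 (x / 2 - y) with hC | hC
      · refine ⟨(-1, 1), by decide, ?_, ?_⟩ <;> norm_num <;> nlinarith
      · refine ⟨(1, -1), by decide, ?_, ?_⟩ <;> norm_num <;> nlinarith

/-- **Adjacent-layer triangle covers every horizontal direction nonnegatively**: for a letter shift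
`σ = ±1` the horizontal pairings of the three shell differences of offsets `threeOffsets σ` sum to
zero, so one of them is `≥ 0`. [folklore] -/
theorem exists_threeOffsets_nonneg {σ : ℤ} (hσ : σ = 1 ∨ σ = -1) (x y : ℝ) :
    ∃ PQ ∈ threeOffsets σ,
      0 ≤ (-(PQ.1 : ℝ) - (PQ.2 : ℝ) / 2 - (σ : ℝ) / 2) * x + (-(PQ.2 : ℝ) - (σ : ℝ) / 3) * y := by
  by_contra hcon
  push Not at hcon
  rcases hσ with rfl | rfl
  · have h1 := hcon (0, 0) (by decide)
    have h2 := hcon (-1, 0) (by decide)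
    have h3 := hcon (0, -1) (by decide)
    norm_num at h1 h2 h3
    linarith
  · have h1 := hcon (0, 0) (by decide)
    have h2 := hcon (1, 0) (by decide)
    have h3 := hcon (0, 1) (by decide)
    norm_num at h1 h2 h3
    linarith

/-- **The numerical step**: if `0 ≤ I`, `a² P / 2 ≤ I²` and `(2/3) a² Q ≤ I²` with
`N² = P + Q`, `0 ≤ N`, `0 ≤ a`, then `(9/20) a N ≤ I` (since `2/7 ≥ 81/400`). [folklore] -/
theorem shell_bound {a I N P Q : ℝ} (ha : 0 ≤ a) (hN : N ^ 2 = P + Q) (hN0 : 0 ≤ N) (hI : 0 ≤ I)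
    (h1 : a ^ 2 * P / 2 ≤ I ^ 2) (h2 : 2 / 3 * a ^ 2 * Q ≤ I ^ 2) : 9 / 20 * a * N ≤ I := by
  have h3 : a ^ 2 * N ^ 2 = a ^ 2 * P + a ^ 2 * Q := by rw [hN]; ring
  have h4 : (9 / 20 * a * N) ^ 2 ≤ I ^ 2 := by nlinarith [sq_nonneg (a * N)]
  exact (pow_le_pow_iff_left₀ (by positivity) hI two_ne_zero).1 h4

/-- **Angular covering of the ideal Barlow touching shell** (stub `stub_barlowShellSupport` of
line `Sketch` of `StackingHinge`): every site `z'` of an ideal Barlow stacking and every vector `e`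
admit a touching neighbour `z''` with `9/20 · a · ‖e‖ ≤ ⟪z'' − z', e⟫`. [folklore] -/
theorem stub_barlowShellSupport : ∀ a : ℝ, 0 < a → ∀ s : ℤ → ℤ, Literature.MathematicalPhysics.StatisticalMechanics.IsHaggSeq s → ∀ z' ∈ Literature.MathematicalPhysics.StatisticalMechanics.barlowStacking a (a * Real.sqrt (2 / 3)) s, ∀ e : EuclideanSpace ℝ (Fin 3), ∃ z'' ∈ Literature.MathematicalPhysics.StatisticalMechanics.barlowStacking a (a * Real.sqrt (2 / 3)) s, dist z' z'' = a ∧ 9 / 20 * a * ‖e‖ ≤ inner ℝ (z'' - z') e := by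
  intro a ha s hs z' hz' e
  set h : ℝ := a * Real.sqrt (2 / 3) with hh_def
  have h23 : Real.sqrt (2 / 3) ^ 2 = 2 / 3 := Real.sq_sqrt (by norm_num)
  have hh : h ^ 2 = 2 / 3 * a ^ 2 := by rw [hh_def, mul_pow, h23]; ring
  have h3 : (√3 : ℝ) ^ 2 = 3 := Real.sq_sqrt (by norm_num)
  obtain ⟨k, i, j, rfl⟩ := hz'
  -- the shell: every image of an offset is a touching site of the stacking
  have hshell : ∀ w, w ∈ offsetPos a h s i j k '' ↑sixOffsets ∪
      (offsetPos a h s i j (k + 1) '' ↑(threeOffsets (-s k)) ∪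
        offsetPos a h s i j (k - 1) '' ↑(threeOffsets (s (k - 1)))) →
      w ∈ barlowStacking a h s ∧ dist (barlowPos a h s k i j) w = a := by
    intro w hw
    rw [← touching_eq_union hs ha hh k i j] at hw
    exact hw
  -- norm in coordinates
  have hnorm : ‖e‖ ^ 2 = ((e 0) ^ 2 + (e 1) ^ 2) + (e 2) ^ 2 := by
    rw [EuclideanSpace.real_norm_sq_eq, Fin.sum_univ_three]
  set P : ℝ := (e 0) ^ 2 + (e 1) ^ 2 with hP_def
  set Q : ℝ := (e 2) ^ 2 with hQ_def
  by_cases hcase : 2 / 3 * a ^ 2 * Q ≤ a ^ 2 * P / 2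
  · -- an in-layer neighbour
    obtain ⟨PQ, hPQ, h0, hsq⟩ := exists_sixOffsets_sq_le (a * e 0) (a * √3 / 2 * e 1)
    obtain ⟨hmem, hdist⟩ := hshell (offsetPos a h s i j k PQ) (Or.inl ⟨PQ, hPQ, rfl⟩)
    refine ⟨offsetPos a h s i j k PQ, hmem, hdist, ?_⟩
    have hI : inner ℝ (offsetPos a h s i j k PQ - barlowPos a h s k i j) e =
        (-(PQ.1 : ℝ) - (PQ.2 : ℝ) / 2) * (a * e 0) + -(PQ.2 : ℝ) * (a * √3 / 2 * e 1) := by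
      rw [inner_offsetPos_sub]; ring
    rw [hI]
    refine shell_bound ha.le hnorm (norm_nonneg e) h0 ?_ ?_
    · have hx : (a * e 0) ^ 2 / 2 + 2 / 3 * (a * √3 / 2 * e 1) ^ 2 = a ^ 2 * P / 2 := by
        rw [hP_def]; linear_combination (a ^ 2 * (e 1) ^ 2 / 6) * h3
      linarith [hsq, hx]
    · have hx : (a * e 0) ^ 2 / 2 + 2 / 3 * (a * √3 / 2 * e 1) ^ 2 = a ^ 2 * P / 2 := by
        rw [hP_def]; linear_combination (a ^ 2 * (e 1) ^ 2 / 6) * h3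
      linarith [hsq, hx]
  · push Not at hcase
    rcases le_or_gt 0 (e 2) with he2 | he2
    · -- an upper neighbour
      have hσ : -s k = 1 ∨ -s k = -1 := by rcases hs k with h1 | h1 <;> omega
      obtain ⟨PQ, hPQ, h0⟩ := exists_threeOffsets_nonneg hσ (a * e 0) (a * √3 / 2 * e 1)
      obtain ⟨hmem, hdist⟩ :=
        hshell (offsetPos a h s i j (k + 1) PQ) (Or.inr (Or.inl ⟨PQ, hPQ, rfl⟩))
      refine ⟨offsetPos a h s i j (k + 1) PQ, hmem, hdist, ?_⟩
      have hI : inner ℝ (offsetPos a h s i j (k + 1) PQ - barlowPos a h s k i j) e =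
          (-(PQ.1 : ℝ) - (PQ.2 : ℝ) / 2 - ((-s k : ℤ) : ℝ) / 2) * (a * e 0) +
            (-(PQ.2 : ℝ) - ((-s k : ℤ) : ℝ) / 3) * (a * √3 / 2 * e 1) + h * e 2 := by
        rw [inner_offsetPos_sub, haggLabel_succ]; push_cast; ring
      rw [hI]
      have hhe : 0 ≤ h * e 2 := mul_nonneg (by positivity) he2
      refine shell_bound ha.le hnorm (norm_nonneg e) (by linarith) ?_ ?_
      · nlinarith [hcase, hh]
      · have : 2 / 3 * a ^ 2 * Q = (h * e 2) ^ 2 := by rw [hQ_def, mul_pow, hh]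
        nlinarith [this]
    · -- a lower neighbour
      have hσ : s (k - 1) = 1 ∨ s (k - 1) = -1 := hs (k - 1)
      obtain ⟨PQ, hPQ, h0⟩ := exists_threeOffsets_nonneg hσ (a * e 0) (a * √3 / 2 * e 1)
      obtain ⟨hmem, hdist⟩ :=
        hshell (offsetPos a h s i j (k - 1) PQ) (Or.inr (Or.inr ⟨PQ, hPQ, rfl⟩))
      refine ⟨offsetPos a h s i j (k - 1) PQ, hmem, hdist, ?_⟩
      have hL : (haggLabel s (k - 1) : ℝ) - haggLabel s k = -s (k - 1) := by
        have := haggLabel_sub_haggLabel_pred s k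
        have h' : ((haggLabel s k - haggLabel s (k - 1) : ℤ) : ℝ) = (s (k - 1) : ℝ) := by
          exact_mod_cast this
        push_cast at h'
        linarith
      have hI : inner ℝ (offsetPos a h s i j (k - 1) PQ - barlowPos a h s k i j) e =
          (-(PQ.1 : ℝ) - (PQ.2 : ℝ) / 2 - ((s (k - 1) : ℤ) : ℝ) / 2) * (a * e 0) +
            (-(PQ.2 : ℝ) - ((s (k - 1) : ℤ) : ℝ) / 3) * (a * √3 / 2 * e 1) + -(h * e 2) := by
        rw [inner_offsetPos_sub, hL]; push_cast; ring
      rw [hI]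
      have hhe : 0 ≤ -(h * e 2) := by
        have : 0 ≤ h * (-e 2) := mul_nonneg (by positivity) (by linarith)
        linarith
      refine shell_bound ha.le hnorm (norm_nonneg e) (by linarith) ?_ ?_
      · have : 2 / 3 * a ^ 2 * Q = (h * e 2) ^ 2 := by rw [hQ_def, mul_pow, hh]
        nlinarith [hcase, this]
      · have : 2 / 3 * a ^ 2 * Q = (h * e 2) ^ 2 := by rw [hQ_def, mul_pow, hh]
        nlinarith [this]

end Summit.AtomisticToContinuum.Crystallization.Theorems.PricedHcpWindowsBarlowShellSupport

end
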